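import Literature.AnabelianGeometry.EtaleTheta.Discharge.Sec1Prop15iiiOfLift
import Literature.AnabelianGeometry.EtaleTheta.ZLawOfGenerators
import Literature.AnabelianGeometry.EtaleTheta.ContH1ConjAction
import Literature.AnabelianGeometry.EtaleTheta.ContH1Lemmas
import HarnessLib

/-!
# [EtTh] Prop. 1.5 (iii): the `Z`-action law on the lift of `η̈^Θ` FROM ONE GENERATOR of `Z` — cocycle
# bookkeeping for the conjugation action on `H¹((Π^tp_Ÿ)^Θ, Δ_Θ)` (proof-only, at the `ThetaSetting` root)

S. Mochizuki, *The étale theta function and its Frobenioid-theoretic manifestations*, Publ. RIMS **45**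
(2009) [EtTh], §1, Prop. 1.5 (iii), PRIMS PDF p. 23 (printed 249): "Any class `η̈^Θ ∈ H¹(Π^tp_Ÿ, Δ_Θ)`
arises from a unique class `η̈^Θ ∈ H¹((Π^tp_Ÿ)^Θ, Δ_Θ)` that maps to `log(Θ)` in the quotient `F̈⁰/F̈¹` and
on which `a ∈ Z ≅ ℤ ≅ Π^tp_X/Π^tp_Y` acts as follows:
`η̈^Θ ↦ η̈^Θ − 2a·log(Ü) − (a²/2)·log(q_X) + log(O^×_K̈)` — where we use the notation 'log' to express the
fact that we wish to write the group structure of `(K̈^×)^∧` additively" [cite: MochizukiEtTh2009, Prop 1.5 (iii) p.23].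
Layer L2 of the abc-iut cell, seat abc-iut-L2-t12 (gen 5), ROW R184 of abc-iut-L2-lead (gen 3) «Prop 1.5 (iii)
FACT → THEOREM, group side at the `ThetaSetting` root in the consumers' binder shape».

THE POINT. abc-iut-L2-t1 types Prop. 1.5 (iii) as the predicate `ThetaSetting.Prop15iii E hC`
(`ThetaCohomology.lean`), whose `Z`-action clause quantifies over EVERY `σ ∈ Π^tp_X`
(`∀ σ, ∃ u ∈ O^×_K̈, σ·x′ = x′ · log(Ü)^{−2a} · κ(q̈)^{−a²} · κ(u)`, `a = toZ σ`), and abc-iut-L2-t6's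
`KummerData.prop15iii_etaleThetaDataOfClass_of_lift` (`Discharge/Sec1Prop15iiiOfLift.lean`) reduces the
whole predicate to that clause for ONE lift `x′` of `η̈^Θ` (binder `hconj`). Print obtains the clause from
the functional equation `Θ̈(q_X^{a/2}·Ü) = (−1)^a q_X^{−a²/2} Ü^{−2a} Θ̈(Ü)` of Prop. 1.4 (ii) — i.e. from the
action of the GENERATOR of `Z` — and the displayed polynomial dependence on `a` is exactly what the cocycle
identity of the conjugation action produces from the generator: if `σ ↦ δ(σ) := σ·x′ − x′` and
`σ·log(Ü) ≡ log(Ü) + a(σ)·log(q̈)`, then `δ(στ) = δ(σ) + σ·δ(τ)` turns `−2a·log(Ü) − a²·log(q̈)` and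
`−2b·log(Ü) − b²·log(q̈)` into `−2(a+b)·log(Ü) − (a+b)²·log(q̈)` (`a² + 2ab + b² = (a+b)²`). This file proves
that bookkeeping once, abstractly, and instantiates it at the root:

* ABSTRACT CORE (`ZLaw.*`, any commutative group `M` written multiplicatively, maps `ρ_σ : M →* M` with
  `ρ_1 = id`, `ρ_{στ} = ρ_σ ∘ ρ_τ`, a "unit" homomorphism `κ : V →* M` with a `ρ`-stable unit subgroup
  `V₀ ≤ V`, an element `q ∈ V` with `ρ_σ κ(q) ∈ κ(q)·κ(V₀)`, and a degree `a : G →* ℤ`):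
  `ZLaw.of_generator` (a predicate closed under products and inverses that holds at one `σ₀` of degree `1`
  and on `Ker a` holds everywhere), the unit law `ρ_σ x ∈ x·κ(V₀)` (`unitLaw_one/mul/inv/closure`), the
  DEGREE-ONE law `ρ_σ L ∈ L·κ(q)^{a(σ)}·κ(V₀)` (`lawL_mul/inv/of_generator`) and the DEGREE-TWO law
  `ρ_σ x ∈ x·L^{−2a(σ)}·κ(q)^{−a(σ)²}·κ(V₀)` given the degree-one law for `L` (`lawX_mul/inv/of_generator`);
* AT THE ROOT (`ThetaSetting.KummerData.*`, for ANY `D : ThetaSetting p`, `E : D.KummerData`, `hC : D.Compat`,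
  `ρ_σ = ContH1.conj (toTheta σ)` on `H¹((Π^tp_Ÿ)^Θ, Δ_Θ)`, `κ = kumYdd ∘ toKddHat`, `V₀ = O^×_K̈`,
  `q = q̈`, `L = log(Ü)`, `a = toZ`): `conj_eq_self_of_mem_GtpYdd` (`Π^tp_Ÿ` acts trivially — inner
  automorphisms), **`logUdd_law_of_generator`** (`σ·log(Ü) = log(Ü)·κ(q̈)^{a}·κ(u)` for all `σ` from the law
  at one `σ₀` with `toZ σ₀ = 1` and on `Π^tp_Y`), **`zLaw_of_generator`** (the `Prop15iii` display / L2-t6's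
  `hconj` VERBATIM for all `σ`, from the law at `σ₀`, on `Π^tp_Y`, the `log(Ü)`-law, unit-class stability
  and `σ·κ(q̈) ∈ κ(q̈)·κ(O^×)`), and the composites **`prop15iii_etaleThetaDataOfClass_of_lift'`** (L2-t6's
  reduction with the unit-class stability in the GALOIS-MOVING form `σ·κ(u) = κ(u′)`, needed when `K̈ ≠ K`)
  and **`prop15iii_etaleThetaDataOfClass_of_generator`** (`Prop15iii` from one lift with `res = log(Θ)`,
  unit classes in `F̈¹`, and the laws AT THE GENERATOR).

So a model-builder (R78 F7/F7q, abc-iut-L2-t6) verifies the printed display ONLY for the deck generator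
(where abc-iut-L2-t12 gen 4's `ThetaDeckConjugation.conj_normalForm_step` is the cochain computation) and
on representatives of `Π^tp_Y/Π^tp_Ÿ`. PROOF-ONLY: no `def`, no instance, no `Prop`-valued definition; the
frozen predicate `Prop15iii` and every consumer's binder are used verbatim. HONEST FRAMING: pure group
cohomology over the [EtTh] §1 interface; nothing of [EtTh] is asserted; typed ≠ proved; no side is taken on
[IUTchIII] Cor. 3.12.
-/

noncomputable section

namespace Literature.AnabelianGeometry.EtaleTheta

/-! ## At the `ThetaSetting` root: the conjugation action on `H¹((Π^tp_Ÿ)^Θ, Δ_Θ)` -/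

namespace ThetaSetting

open Literature.AnabelianGeometry.SemiGraphs

variable {p : ℕ} [Fact p.Prime] {D : ThetaSetting p}

/-- **`Π^tp_Ÿ` acts trivially** on `H¹((Π^tp_Ÿ)^Θ, Δ_Θ)` (inner automorphisms), so the laws below need
checking only on representatives of `Π^tp_X/Π^tp_Ÿ`. [cite: MochizukiEtTh2009, Prop 1.5 (iii) p.23] -/
theorem conj_eq_self_of_mem_GtpYdd (hC : D.Compat) {y : D.PiTemp} (hy : y ∈ D.GtpYdd)
    (z : D.H1Theta (D.GtpYdd.map D.toTheta)) :
    haveI := hC.GtpYddTheta_normal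
    ContH1.conj (MonoidHom.id D.GtpTheta) D.DeltaTheta (D.toTheta y) z = z := by
  haveI := hC.GtpYddTheta_normal
  exact ContH1.conj_eq_self_of_mem _ (Subgroup.mem_map_of_mem D.toTheta hy) z

/-- An element of degree `1` exists (`toZ` is onto `ℤ`). [cite: MochizukiEtTh2009, §1 p.12] -/
theorem exists_toZ_eq_ofAdd_one : ∃ σ₀ : D.PiTemp, D.toZ σ₀ = Multiplicative.ofAdd 1 :=
  D.toZ_surjective _

/-- `y ∈ Π^tp_Y ↔ toZ y = 1`. [cite: MochizukiEtTh2009, §1 p.12] -/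
theorem mem_GtpY_iff_toZ {y : D.PiTemp} : y ∈ D.GtpY ↔ D.toZ y = 1 := MonoidHom.mem_ker

/-- The conjugation action through `toTheta` is an action: `(στ)·z = σ·(τ·z)` and `1·z = z`.
[cite: MochizukiEtTh2009, Prop 1.5 (iii) p.23] -/
theorem conj_toTheta_mul (hC : D.Compat) (σ τ : D.PiTemp) (z : D.H1Theta (D.GtpYdd.map D.toTheta)) :
    haveI := hC.GtpYddTheta_normal
    ContH1.conj (MonoidHom.id D.GtpTheta) D.DeltaTheta (D.toTheta (σ * τ)) z =
      ContH1.conj (MonoidHom.id D.GtpTheta) D.DeltaTheta (D.toTheta σ)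
        (ContH1.conj (MonoidHom.id D.GtpTheta) D.DeltaTheta (D.toTheta τ) z) := by
  haveI := hC.GtpYddTheta_normal
  rw [map_mul, ContH1.conj_mul_apply]

/-- [cite: MochizukiEtTh2009, Prop 1.5 (iii) p.23] -/
theorem conj_toTheta_one (hC : D.Compat) (z : D.H1Theta (D.GtpYdd.map D.toTheta)) :
    haveI := hC.GtpYddTheta_normal
    ContH1.conj (MonoidHom.id D.GtpTheta) D.DeltaTheta (D.toTheta 1) z = z := by
  haveI := hC.GtpYddTheta_normal
  rw [map_one, ContH1.conj_one_apply]

namespace KummerData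

variable (E : D.KummerData)

/-- **The `log(Ü)`-law from a generator**: if `σ₀·log(Ü) = log(Ü)·κ(q̈)·κ(u₀)` for ONE `σ₀` with
`toZ σ₀ = 1` (the deck generator: `Ü ↦ q̈·Ü` up to a unit) and `Π^tp_Y` moves `log(Ü)` by unit classes only,
then `σ·log(Ü) = log(Ü)·κ(q̈)^{toZ σ}·κ(u_σ)` for every `σ ∈ Π^tp_X` — given that conjugation permutes the unit
classes and moves `κ(q̈)` by a unit class (`q̈ ↦ ±q̈`). [cite: MochizukiEtTh2009, Prop 1.5 (iii) p.23] -/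
theorem logUdd_law_of_generator (hC : D.Compat)
    (hU : haveI := hC.GtpYddTheta_normal
      ∀ σ : D.PiTemp, ∀ u ∈ D.unitsOKdd, ∃ u' ∈ D.unitsOKdd,
        ContH1.conj (MonoidHom.id D.GtpTheta) D.DeltaTheta (D.toTheta σ) (E.kumYdd (E.toKddHat u)) =
          E.kumYdd (E.toKddHat u'))
    (hQ : haveI := hC.GtpYddTheta_normal
      ∀ σ : D.PiTemp, ∃ u ∈ D.unitsOKdd,
        ContH1.conj (MonoidHom.id D.GtpTheta) D.DeltaTheta (D.toTheta σ) (E.kumYdd (E.toKddHat D.qddUnit)) =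
          E.kumYdd (E.toKddHat D.qddUnit) * E.kumYdd (E.toKddHat u))
    {σ₀ : D.PiTemp} (hσ₀ : D.toZ σ₀ = Multiplicative.ofAdd 1)
    (hL₀ : haveI := hC.GtpYddTheta_normal
      ∃ u ∈ D.unitsOKdd, ContH1.conj (MonoidHom.id D.GtpTheta) D.DeltaTheta (D.toTheta σ₀) E.logUdd =
        E.logUdd * E.kumYdd (E.toKddHat D.qddUnit) * E.kumYdd (E.toKddHat u))
    (hLY : haveI := hC.GtpYddTheta_normal
      ∀ y ∈ D.GtpY, ∃ u ∈ D.unitsOKdd,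
        ContH1.conj (MonoidHom.id D.GtpTheta) D.DeltaTheta (D.toTheta y) E.logUdd =
          E.logUdd * E.kumYdd (E.toKddHat u)) :
    haveI := hC.GtpYddTheta_normal
    ∀ σ : D.PiTemp, ∃ u ∈ D.unitsOKdd,
      ContH1.conj (MonoidHom.id D.GtpTheta) D.DeltaTheta (D.toTheta σ) E.logUdd =
        E.logUdd * E.kumYdd (E.toKddHat D.qddUnit) ^ Multiplicative.toAdd (D.toZ σ) *
          E.kumYdd (E.toKddHat u) := by
  haveI := hC.GtpYddTheta_normal
  refine ZLaw.lawL_of_generator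
    (ρ := fun σ => ContH1.conj (MonoidHom.id D.GtpTheta) D.DeltaTheta (D.toTheta σ))
    (κ := E.kumYdd.comp E.toKddHat) (V₀ := D.unitsOKdd) (a := D.toZ) (q := D.qddUnit) (L := E.logUdd)
    (conj_toTheta_one hC) (conj_toTheta_mul hC) hU hQ hσ₀ ?_ ?_
  · simpa only [hσ₀, toAdd_ofAdd, zpow_one, MonoidHom.comp_apply] using hL₀
  · intro y hy
    exact hLY y (mem_GtpY_iff_toZ.mpr hy)

/-- **Prop. 1.5 (iii), the `Z`-action law FROM A GENERATOR**: if the printed display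
`σ·x′ = x′ · log(Ü)^{−2a} · κ(q̈)^{−a²} · κ(u)` holds for ONE `σ₀` with `a = toZ σ₀ = 1`
(i.e. `σ₀·x′ = x′·log(Ü)^{−2}·κ(q̈)^{−1}·κ(u₀)`) and `Π^tp_Y` moves `x′` by unit classes only, then it holds
for EVERY `σ ∈ Π^tp_X` — given the `log(Ü)`-law `σ·log(Ü) = log(Ü)·κ(q̈)^{a}·κ(u)`, unit-class stability and
`σ·κ(q̈) ∈ κ(q̈)·κ(O^×_K̈)`. The conclusion is the `Z`-action clause of `ThetaSetting.Prop15iii` / the binder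
`hconj` of `KummerData.prop15iii_etaleThetaDataOfClass_of_lift`, verbatim.
[cite: MochizukiEtTh2009, Prop 1.5 (iii) p.23] -/
theorem zLaw_of_generator (hC : D.Compat) (x' : D.H1Theta (D.GtpYdd.map D.toTheta))
    (hU : haveI := hC.GtpYddTheta_normal
      ∀ σ : D.PiTemp, ∀ u ∈ D.unitsOKdd, ∃ u' ∈ D.unitsOKdd,
        ContH1.conj (MonoidHom.id D.GtpTheta) D.DeltaTheta (D.toTheta σ) (E.kumYdd (E.toKddHat u)) =
          E.kumYdd (E.toKddHat u'))
    (hQ : haveI := hC.GtpYddTheta_normal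
      ∀ σ : D.PiTemp, ∃ u ∈ D.unitsOKdd,
        ContH1.conj (MonoidHom.id D.GtpTheta) D.DeltaTheta (D.toTheta σ) (E.kumYdd (E.toKddHat D.qddUnit)) =
          E.kumYdd (E.toKddHat D.qddUnit) * E.kumYdd (E.toKddHat u))
    (hL : haveI := hC.GtpYddTheta_normal
      ∀ σ : D.PiTemp, ∃ u ∈ D.unitsOKdd,
        ContH1.conj (MonoidHom.id D.GtpTheta) D.DeltaTheta (D.toTheta σ) E.logUdd =
          E.logUdd * E.kumYdd (E.toKddHat D.qddUnit) ^ Multiplicative.toAdd (D.toZ σ) *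
            E.kumYdd (E.toKddHat u))
    {σ₀ : D.PiTemp} (hσ₀ : D.toZ σ₀ = Multiplicative.ofAdd 1)
    (hx₀ : haveI := hC.GtpYddTheta_normal
      ∃ u ∈ D.unitsOKdd, ContH1.conj (MonoidHom.id D.GtpTheta) D.DeltaTheta (D.toTheta σ₀) x' =
        x' * E.logUdd ^ (-(2 : ℤ)) * E.kumYdd (E.toKddHat D.qddUnit) ^ (-(1 : ℤ)) * E.kumYdd (E.toKddHat u))
    (hxY : haveI := hC.GtpYddTheta_normal
      ∀ y ∈ D.GtpY, ∃ u ∈ D.unitsOKdd,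
        ContH1.conj (MonoidHom.id D.GtpTheta) D.DeltaTheta (D.toTheta y) x' = x' * E.kumYdd (E.toKddHat u)) :
    haveI := hC.GtpYddTheta_normal
    ∀ σ : D.PiTemp, ∃ u ∈ D.unitsOKdd,
      ContH1.conj (MonoidHom.id D.GtpTheta) D.DeltaTheta (D.toTheta σ) x' =
        x' * E.logUdd ^ (-(2 * Multiplicative.toAdd (D.toZ σ)))
           * E.kumYdd (E.toKddHat D.qddUnit) ^
              (-(Multiplicative.toAdd (D.toZ σ) * Multiplicative.toAdd (D.toZ σ)))
           * E.kumYdd (E.toKddHat u) := by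
  haveI := hC.GtpYddTheta_normal
  refine ZLaw.lawX_of_generator
    (ρ := fun σ => ContH1.conj (MonoidHom.id D.GtpTheta) D.DeltaTheta (D.toTheta σ))
    (κ := E.kumYdd.comp E.toKddHat) (V₀ := D.unitsOKdd) (a := D.toZ) (q := D.qddUnit) (L := E.logUdd)
    (x := x') (conj_toTheta_one hC) (conj_toTheta_mul hC) hU hQ hL hσ₀ ?_ ?_
  · simpa only [hσ₀, toAdd_ofAdd, mul_one, MonoidHom.comp_apply] using hx₀
  · intro y hy
    exact hxY y (mem_GtpY_iff_toZ.mpr hy)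

/-- The same with the `log(Ü)`-law also supplied at the generator only.
[cite: MochizukiEtTh2009, Prop 1.5 (iii) p.23] -/
theorem zLaw_of_generator' (hC : D.Compat) (x' : D.H1Theta (D.GtpYdd.map D.toTheta))
    (hU : haveI := hC.GtpYddTheta_normal
      ∀ σ : D.PiTemp, ∀ u ∈ D.unitsOKdd, ∃ u' ∈ D.unitsOKdd,
        ContH1.conj (MonoidHom.id D.GtpTheta) D.DeltaTheta (D.toTheta σ) (E.kumYdd (E.toKddHat u)) =
          E.kumYdd (E.toKddHat u'))
    (hQ : haveI := hC.GtpYddTheta_normal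
      ∀ σ : D.PiTemp, ∃ u ∈ D.unitsOKdd,
        ContH1.conj (MonoidHom.id D.GtpTheta) D.DeltaTheta (D.toTheta σ) (E.kumYdd (E.toKddHat D.qddUnit)) =
          E.kumYdd (E.toKddHat D.qddUnit) * E.kumYdd (E.toKddHat u))
    {σ₀ : D.PiTemp} (hσ₀ : D.toZ σ₀ = Multiplicative.ofAdd 1)
    (hL₀ : haveI := hC.GtpYddTheta_normal
      ∃ u ∈ D.unitsOKdd, ContH1.conj (MonoidHom.id D.GtpTheta) D.DeltaTheta (D.toTheta σ₀) E.logUdd =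
        E.logUdd * E.kumYdd (E.toKddHat D.qddUnit) * E.kumYdd (E.toKddHat u))
    (hLY : haveI := hC.GtpYddTheta_normal
      ∀ y ∈ D.GtpY, ∃ u ∈ D.unitsOKdd,
        ContH1.conj (MonoidHom.id D.GtpTheta) D.DeltaTheta (D.toTheta y) E.logUdd =
          E.logUdd * E.kumYdd (E.toKddHat u))
    (hx₀ : haveI := hC.GtpYddTheta_normal
      ∃ u ∈ D.unitsOKdd, ContH1.conj (MonoidHom.id D.GtpTheta) D.DeltaTheta (D.toTheta σ₀) x' =
        x' * E.logUdd ^ (-(2 : ℤ)) * E.kumYdd (E.toKddHat D.qddUnit) ^ (-(1 : ℤ)) * E.kumYdd (E.toKddHat u))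
    (hxY : haveI := hC.GtpYddTheta_normal
      ∀ y ∈ D.GtpY, ∃ u ∈ D.unitsOKdd,
        ContH1.conj (MonoidHom.id D.GtpTheta) D.DeltaTheta (D.toTheta y) x' = x' * E.kumYdd (E.toKddHat u)) :
    haveI := hC.GtpYddTheta_normal
    ∀ σ : D.PiTemp, ∃ u ∈ D.unitsOKdd,
      ContH1.conj (MonoidHom.id D.GtpTheta) D.DeltaTheta (D.toTheta σ) x' =
        x' * E.logUdd ^ (-(2 * Multiplicative.toAdd (D.toZ σ)))
           * E.kumYdd (E.toKddHat D.qddUnit) ^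
              (-(Multiplicative.toAdd (D.toZ σ) * Multiplicative.toAdd (D.toZ σ)))
           * E.kumYdd (E.toKddHat u) :=
  E.zLaw_of_generator hC x' hU hQ (E.logUdd_law_of_generator hC hU hQ hσ₀ hL₀ hLY) hσ₀ hx₀ hxY

/-! ### Composites with abc-iut-L2-t6's one-lift reduction -/

/-- abc-iut-L2-t6's `prop15iii_etaleThetaDataOfClass_of_lift` with the unit-class stability in the
GALOIS-MOVING form `σ·κ(u) = κ(u′)` (`u′ = σ̄(u)`; the fixed form `σ·κ(u) = κ(u)` is its special case and is
only right when `Π^tp_X` fixes `K̈` pointwise). [cite: MochizukiEtTh2009, Prop 1.5 (iii) p.23] -/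
theorem prop15iii_etaleThetaDataOfClass_of_lift' (hC : D.Compat) (η : D.H1 D.GtpYdd)
    (x' : D.H1Theta (D.GtpYdd.map D.toTheta))
    (hx' : D.inflTheta D.GtpYdd x' = η)
    (hres : ContH1.res (MonoidHom.id D.GtpTheta) D.DeltaTheta
      (hC.deltaTheta_le_DtpYddTheta.trans (Subgroup.map_mono inf_le_left)) x' = D.logTheta)
    (hkres : ∀ u ∈ D.unitsOKdd, ContH1.res (MonoidHom.id D.GtpTheta) D.DeltaTheta
      (hC.deltaTheta_le_DtpYddTheta.trans (Subgroup.map_mono inf_le_left)) (E.kumYdd (E.toKddHat u)) = 1)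
    (hU : haveI := hC.GtpYddTheta_normal
      ∀ σ : D.PiTemp, ∀ u ∈ D.unitsOKdd, ∃ u' ∈ D.unitsOKdd,
        ContH1.conj (MonoidHom.id D.GtpTheta) D.DeltaTheta (D.toTheta σ) (E.kumYdd (E.toKddHat u)) =
          E.kumYdd (E.toKddHat u'))
    (hconj : haveI := hC.GtpYddTheta_normal
      ∀ σ : D.PiTemp, ∃ u ∈ D.unitsOKdd,
        ContH1.conj (MonoidHom.id D.GtpTheta) D.DeltaTheta (D.toTheta σ) x' =
          x' * E.logUdd ^ (-(2 * Multiplicative.toAdd (D.toZ σ)))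
             * E.kumYdd (E.toKddHat D.qddUnit) ^
                (-(Multiplicative.toAdd (D.toZ σ) * Multiplicative.toAdd (D.toZ σ)))
             * E.kumYdd (E.toKddHat u)) :
    Prop15iii (E.etaleThetaDataOfClass η) hC := by
  haveI := hC.GtpYddTheta_normal
  intro x hx
  obtain ⟨v, hv, rfl⟩ := (E.mem_thetaClasses_etaleThetaDataOfClass_iff η x).mp hx
  refine ⟨E.kumYdd (E.toKddHat v) * x', ⟨?_, ?_, ?_⟩, ?_⟩
  · rw [map_mul, hx']
  · have h1 := (ContH1.res (MonoidHom.id D.GtpTheta) D.DeltaTheta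
      (hC.deltaTheta_le_DtpYddTheta.trans (Subgroup.map_mono inf_le_left))).map_mul
      (E.kumYdd (E.toKddHat v)) x'
    rw [hkres v hv, hres, one_mul] at h1
    exact h1
  · intro σ
    obtain ⟨u, hu, hσ⟩ := hconj σ
    obtain ⟨v', hv', hvσ⟩ := hU σ v hv
    refine ⟨u * v' * v⁻¹, D.unitsOKdd.mul_mem (D.unitsOKdd.mul_mem hu hv') (D.unitsOKdd.inv_mem hv), ?_⟩
    change ContH1.conj (MonoidHom.id D.GtpTheta) D.DeltaTheta (D.toTheta σ) (E.kumYdd (E.toKddHat v) * x') =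
      E.kumYdd (E.toKddHat v) * x' * E.logUdd ^ (-(2 * Multiplicative.toAdd (D.toZ σ)))
        * E.kumYdd (E.toKddHat D.qddUnit) ^
          (-(Multiplicative.toAdd (D.toZ σ) * Multiplicative.toAdd (D.toZ σ)))
        * E.kumYdd (E.toKddHat (u * v' * v⁻¹))
    rw [map_mul, hvσ, hσ]
    simp only [map_mul, map_inv]
    apply Additive.ofMul.injective
    simp only [ofMul_mul, ofMul_zpow, ofMul_inv]
    module
  · rintro y ⟨hy, -, -⟩
    apply D.inflTheta_injective D.GtpYdd
    rw [hy, map_mul, hx']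

/-- **Prop. 1.5 (iii) at `etaleThetaDataOfClass E η` FROM THE LAW AT A GENERATOR**: one lift `x′` of `η`
with `res_{Δ_Θ} x′ = log(Θ)`, unit classes dying on `Δ_Θ` and permuted by conjugation, `σ·κ(q̈) ∈ κ(q̈)·κ(O^×)`,
and the two displays — for `log(Ü)` and for `x′` — at ONE `σ₀` of degree `1` and on `Π^tp_Y`.
[cite: MochizukiEtTh2009, Prop 1.5 (iii) p.23] -/
theorem prop15iii_etaleThetaDataOfClass_of_generator (hC : D.Compat) (η : D.H1 D.GtpYdd)
    (x' : D.H1Theta (D.GtpYdd.map D.toTheta))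
    (hx' : D.inflTheta D.GtpYdd x' = η)
    (hres : ContH1.res (MonoidHom.id D.GtpTheta) D.DeltaTheta
      (hC.deltaTheta_le_DtpYddTheta.trans (Subgroup.map_mono inf_le_left)) x' = D.logTheta)
    (hkres : ∀ u ∈ D.unitsOKdd, ContH1.res (MonoidHom.id D.GtpTheta) D.DeltaTheta
      (hC.deltaTheta_le_DtpYddTheta.trans (Subgroup.map_mono inf_le_left)) (E.kumYdd (E.toKddHat u)) = 1)
    (hU : haveI := hC.GtpYddTheta_normal
      ∀ σ : D.PiTemp, ∀ u ∈ D.unitsOKdd, ∃ u' ∈ D.unitsOKdd,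
        ContH1.conj (MonoidHom.id D.GtpTheta) D.DeltaTheta (D.toTheta σ) (E.kumYdd (E.toKddHat u)) =
          E.kumYdd (E.toKddHat u'))
    (hQ : haveI := hC.GtpYddTheta_normal
      ∀ σ : D.PiTemp, ∃ u ∈ D.unitsOKdd,
        ContH1.conj (MonoidHom.id D.GtpTheta) D.DeltaTheta (D.toTheta σ) (E.kumYdd (E.toKddHat D.qddUnit)) =
          E.kumYdd (E.toKddHat D.qddUnit) * E.kumYdd (E.toKddHat u))
    {σ₀ : D.PiTemp} (hσ₀ : D.toZ σ₀ = Multiplicative.ofAdd 1)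
    (hL₀ : haveI := hC.GtpYddTheta_normal
      ∃ u ∈ D.unitsOKdd, ContH1.conj (MonoidHom.id D.GtpTheta) D.DeltaTheta (D.toTheta σ₀) E.logUdd =
        E.logUdd * E.kumYdd (E.toKddHat D.qddUnit) * E.kumYdd (E.toKddHat u))
    (hLY : haveI := hC.GtpYddTheta_normal
      ∀ y ∈ D.GtpY, ∃ u ∈ D.unitsOKdd,
        ContH1.conj (MonoidHom.id D.GtpTheta) D.DeltaTheta (D.toTheta y) E.logUdd =
          E.logUdd * E.kumYdd (E.toKddHat u))
    (hx₀ : haveI := hC.GtpYddTheta_normal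
      ∃ u ∈ D.unitsOKdd, ContH1.conj (MonoidHom.id D.GtpTheta) D.DeltaTheta (D.toTheta σ₀) x' =
        x' * E.logUdd ^ (-(2 : ℤ)) * E.kumYdd (E.toKddHat D.qddUnit) ^ (-(1 : ℤ)) * E.kumYdd (E.toKddHat u))
    (hxY : haveI := hC.GtpYddTheta_normal
      ∀ y ∈ D.GtpY, ∃ u ∈ D.unitsOKdd,
        ContH1.conj (MonoidHom.id D.GtpTheta) D.DeltaTheta (D.toTheta y) x' = x' * E.kumYdd (E.toKddHat u)) :
    Prop15iii (E.etaleThetaDataOfClass η) hC :=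
  E.prop15iii_etaleThetaDataOfClass_of_lift' hC η x' hx' hres hkres hU
    (E.zLaw_of_generator' hC x' hU hQ hσ₀ hL₀ hLY hx₀ hxY)

end KummerData

end ThetaSetting

end Literature.AnabelianGeometry.EtaleTheta

end
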